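import Summits.ValiantsHypothesis.ValiantsHypothesis.Theorems.LacunarySymmetroidMatrixDescartesDoorA26WallBubblingWeylTripleLimit
import Summits.ValiantsHypothesis.ValiantsHypothesis.Theorems.LacunarySymmetroidMatrixDescartesDoorA26WallBubblingConfluentClusters

/-!
# Wall bubbling for `DoorA26` — CHAINS SPLIT INTO A WINDOW CASE AND A SPREAD CASE; the [3,1,1,1] chain reduced to its spread case

HONEST FRAMING.  Bookkeeping toward `TripleStratum26` of `Cruxes/DoorA26/Lines/wall_bubbling_ConfluentDoor.lean` (rev 13; crux `DoorA26`,
stmt-ValiantsHypothesis-19979 — OPEN, typed, never asserted).  W1 seat val-sym-door-p2 g15 (#110).  #91 `tripleStratum26_of_chains` reduces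
`TripleStratum26` to six CHAIN statements `h3111 … h51` («no sequence of twenties converging to a point of the stratum»).  A chain splits by
RECENTRING at the first zero (`z ν 0 = 0`, letters `e^{δ_l z_0}U_l`, `pencil_recenter`) and a subsequence dichotomy on the spread `z ν 19`:

* `twenties_window_or_spread` — pattern-free: if twenties in every FIXED WINDOW are impossible along every subsequence (the single-cluster
  theorems #89/#97/#104/#109) and twenties with first zero `0` and SPREAD `z ν 19 → +∞` are impossible (the multi-cluster case — OPEN), the chain holds;
* **`h3111_of_spread`** — the chain `h3111` of #91 follows from its SPREAD CASE ALONE, by the kernel theorem #89 `no_twenty_window_weylTriple`.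

So the [3,1,1,1] contribution to `TripleStratum26` is reduced to ONE named statement: «no twenties with z₀ = 0 and z₁₉ → ∞ converging to a
value-generic Weyl triple» (memo TRIPLE-STRATUM-g15 §3: chain ceiling 20 vs 19, the sixth-slot cluster).  The same split for [3,2,1]/[4,1,1]/[5,1]
follows in #111 once #97/#104/#109 land.  Nothing here bears on `DoorA26`, `MatrixDescartes` (stmt-ValiantsHypothesis-18050) or `VP ≠ VNP`;
`TripleStratum26`, (W), (M) OPEN.  `--supports stmt-ValiantsHypothesis-19979 --as helper`.  [this work].
-/

-- `Summit.ValiantsHypothesis.ValiantsHypothesis.…` repeats a component by the D-0017 layout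
-- (single-conjunct summit), which the `dupNamespace` linter flags; the name is mandated.
set_option linter.dupNamespace false

namespace Summit.ValiantsHypothesis.ValiantsHypothesis.Theorems.LacunarySymmetroidMatrixDescartes.WallBubbling

open Finset Filter Topology
open scoped BigOperators

/-- **A CHAIN SPLITS INTO A WINDOW CASE AND A SPREAD CASE** (pattern-free).  Twenties `z ν` of the pencils `Σ_l e^{δs ν l·t}U ν l`: recentred at
the first zero they are twenties of the pencils with letters `e^{δs ν l·z ν 0}U ν l`; either the spread stays bounded along a subsequence (a window
`[0, B]`) or it tends to `+∞`. [this work] -/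
theorem twenties_window_or_spread (δs : ℕ → Fin 6 → ℝ)
    (U : ℕ → Fin 6 → Matrix (Fin 2) (Fin 2) ℝ) (hU : ∀ ν l, (U ν l).IsSymm)
    (hne : ∀ ν, ∃ t, (∑ l, Real.exp (δs ν l * t) • U ν l).det ≠ 0)
    (z : ℕ → Fin 20 → ℝ) (hz : ∀ ν, StrictMono (z ν)) (hroot : ∀ ν i, (∑ l, Real.exp (δs ν l * z ν i) • U ν l).det = 0)
    (hwin : ∀ φ : ℕ → ℕ, StrictMono φ → ∀ (V : ℕ → Fin 6 → Matrix (Fin 2) (Fin 2) ℝ), (∀ ν l, (V ν l).IsSymm) →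
      (∀ ν, ∃ t, (∑ l, Real.exp (δs (φ ν) l * t) • V ν l).det ≠ 0) → ∀ A B : ℝ,
      (∀ ν, ∃ y : Fin 20 → ℝ, StrictMono y ∧ ∀ i, y i ∈ Set.Icc A B ∧ (∑ l, Real.exp (δs (φ ν) l * y i) • V ν l).det = 0) → False)
    (hspread : ∀ (V : ℕ → Fin 6 → Matrix (Fin 2) (Fin 2) ℝ), (∀ ν l, (V ν l).IsSymm) →
      (∀ ν, ∃ t, (∑ l, Real.exp (δs ν l * t) • V ν l).det ≠ 0) → ∀ (y : ℕ → Fin 20 → ℝ), (∀ ν, StrictMono (y ν)) → (∀ ν, y ν 0 = 0) →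
      Tendsto (fun ν => y ν 19) atTop atTop → (∀ ν i, (∑ l, Real.exp (δs ν l * y ν i) • V ν l).det = 0) → False) : False := by
  -- recentre at the first zero
  set V : ℕ → Fin 6 → Matrix (Fin 2) (Fin 2) ℝ := fun ν l => Real.exp (δs ν l * z ν 0) • U ν l with hV
  set y : ℕ → Fin 20 → ℝ := fun ν i => z ν i - z ν 0 with hy
  have hVsymm : ∀ ν l, (V ν l).IsSymm := fun ν l => (hU ν l).smul _
  have hrec : ∀ ν u, (∑ l, Real.exp (δs ν l * u) • V ν l).det = (∑ l, Real.exp (δs ν l * (z ν 0 + u)) • U ν l).det :=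
    fun ν u => (pencil_recenter (δs ν) (U ν) (z ν 0) u).symm
  have hneV : ∀ ν, ∃ t, (∑ l, Real.exp (δs ν l * t) • V ν l).det ≠ 0 := by
    intro ν
    obtain ⟨t, ht⟩ := hne ν
    refine ⟨t - z ν 0, ?_⟩
    rw [hrec, show z ν 0 + (t - z ν 0) = t by ring]
    exact ht
  have hrootV : ∀ ν i, (∑ l, Real.exp (δs ν l * y ν i) • V ν l).det = 0 := by
    intro ν i
    rw [hrec, show z ν 0 + y ν i = z ν i by simp only [hy]; ring]
    exact hroot ν i
  have hymono : ∀ ν, StrictMono (y ν) := fun ν a b hab => sub_lt_sub_right (hz ν hab) _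
  have hy0 : ∀ ν, y ν 0 = 0 := fun ν => sub_self _
  have hyIcc : ∀ ν i, 0 ≤ y ν i ∧ y ν i ≤ y ν 19 := fun ν i =>
    ⟨by rw [← hy0 ν]; exact (hymono ν).monotone (Fin.zero_le i), (hymono ν).monotone (Fin.le_last i)⟩
  by_cases hb : ∃ B : ℝ, ∃ᶠ ν in atTop, y ν 19 ≤ B
  · -- bounded spread along a subsequence: a window `[0, B]`
    obtain ⟨B, hB⟩ := hb
    obtain ⟨φ, hφ, hφB⟩ := Filter.extraction_of_frequently_atTop hB
    exact hwin φ hφ (fun ν => V (φ ν)) (fun ν l => hVsymm _ l) (fun ν => hneV _) 0 B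
      (fun ν => ⟨y (φ ν), hymono _, fun i => ⟨⟨(hyIcc _ i).1, (hyIcc _ i).2.trans (hφB ν)⟩, hrootV _ i⟩⟩)
  · -- the spread tends to `+∞`
    have htend : Tendsto (fun ν => y ν 19) atTop atTop := by
      refine Filter.tendsto_atTop.mpr fun B => ?_
      have hB : ¬ ∃ᶠ ν in atTop, y ν 19 ≤ B := fun h => hb ⟨B, h⟩
      exact (Filter.not_frequently.mp hB).mono fun ν hν => le_of_lt (not_le.mp hν)
    exact hspread V hVsymm hneV y hymono hy0 htend hrootV

/-- **THE CHAIN `h3111` OF #91 FOLLOWS FROM ITS SPREAD CASE** (the window case is the kernel theorem #89 `no_twenty_window_weylTriple`).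
Positions: triple at `3,4,5`, the four values `δ0 0, δ0 1, δ0 2, δ0 3` 2-Sidon. [this work] -/
theorem h3111_of_spread
    (hspread : ∀ (δs : ℕ → Fin 6 → ℝ) (δ0 : Fin 6 → ℝ), (∀ l, Tendsto (fun ν => δs ν l) atTop (𝓝 (δ0 l))) →
      δ0 4 = δ0 3 → δ0 5 = δ0 3 →
      (∀ a b c d : Fin 4, δ0 a.castSucc.castSucc + δ0 b.castSucc.castSucc = δ0 c.castSucc.castSucc + δ0 d.castSucc.castSucc →
        (a = c ∧ b = d) ∨ (a = d ∧ b = c)) →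
      ∀ (U : ℕ → Fin 6 → Matrix (Fin 2) (Fin 2) ℝ), (∀ ν l, (U ν l).IsSymm) →
      (∀ ν, ∃ t, (∑ l, Real.exp (δs ν l * t) • U ν l).det ≠ 0) →
      ∀ (z : ℕ → Fin 20 → ℝ), (∀ ν, StrictMono (z ν)) → (∀ ν, z ν 0 = 0) → Tendsto (fun ν => z ν 19) atTop atTop →
      (∀ ν i, (∑ l, Real.exp (δs ν l * z ν i) • U ν l).det = 0) → False) :
    ∀ (δs : ℕ → Fin 6 → ℝ) (δ0 : Fin 6 → ℝ), (∀ l, Tendsto (fun ν => δs ν l) atTop (𝓝 (δ0 l))) →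
      δ0 4 = δ0 3 → δ0 5 = δ0 3 →
      (∀ a b c d : Fin 4, δ0 a.castSucc.castSucc + δ0 b.castSucc.castSucc = δ0 c.castSucc.castSucc + δ0 d.castSucc.castSucc →
        (a = c ∧ b = d) ∨ (a = d ∧ b = c)) →
      ∀ (U : ℕ → Fin 6 → Matrix (Fin 2) (Fin 2) ℝ), (∀ ν l, (U ν l).IsSymm) →
      (∀ ν, ∃ t, (∑ l, Real.exp (δs ν l * t) • U ν l).det ≠ 0) →
      ∀ (z : ℕ → Fin 20 → ℝ), (∀ ν, StrictMono (z ν)) → (∀ ν i, (∑ l, Real.exp (δs ν l * z ν i) • U ν l).det = 0) → False := by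
  intro δs δ0 hδ h43 h53 hvg U hU hne z hz hroot
  refine twenties_window_or_spread δs U hU hne z hz hroot (fun φ hφ V hV hneV A B hw => ?_) (fun V hV hneV y hy hy0 ht hr => ?_)
  · exact no_twenty_window_weylTriple (fun ν => δs (φ ν)) δ0 (fun l => (hδ l).comp hφ.tendsto_atTop) h43 h53 hvg V hV hneV A B hw
  · exact hspread δs δ0 hδ h43 h53 hvg V hV hneV y hy hy0 ht hr

end Summit.ValiantsHypothesis.ValiantsHypothesis.Theorems.LacunarySymmetroidMatrixDescartes.WallBubbling
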